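import Mathlib
import HarnessLib
import Summits.NavierStokesRegularity.NavierStokesRegularity.Theorems.UnthreadedRigidityDoorUnthreadedRigidityVirialHornOrderTwoLaw

/-!
# Route `UnthreadedRigidityDoor`, wall item W2 `UnthreadedRigidity` (stmt-NavierStokesRegularity-27585) — LINE g12-2 «PERSISTENCE FILTER»
# (ns-idea-6 g12, `Persistence_sketch.lean` 09bc8f71301208c4; idea-crit-7 PASS B+; DIRECTOR-NS #294 / KEY-NS #211): bridge L
# «LAMB-CURL IDENTITY» `SingleShellLambCurlIdentity`, VERBATIM (the sketch-local `lambCurl` / `lambPot` / `balAmp` unfolded)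

Seat ns-es-p1 g9 (W2 second queue; announce-before-propose on the ideators bus).

For the single separable shell `u = sepShellL H Y x₀ = curl curl (H(|y|) Y(y) y)` of a solid harmonic `Y` of degree `l` with a
virial-admissible profile `H(r) = h(r²)`, the curl of the Lamb vector `ω × u` (`ω = curl u`) is, off the centre,
`curl(ω × u)(x₀ + y) = ∇ψ(y) × y`, `ψ = −K(|y|)α(|y|) |∇Y|² + b_l[H](|y|) Y²`, `α = strainAmpL = rH′ + (l+1)H`, `K = vortAmpL = H″ + 2(l+1)H′/r`,
`b_l[H](r) = (l/2r)((l−1) K H′ − (l+1) K′ H)` — the explicit-field identity that turns the vorticity equation of a persistent shell into the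
toroidal balance of the line (bridge L of the sketch; EXACT-checked there on five `(l, Y)` cases in rational arithmetic).

* §1 radial factors pass through `∇(·) × y` (`cross_gradient_radial_mul`, `gradient_radial_mul`), `∇(Y²) = 2Y∇Y`;
* §2 `curl_cross_vorticity_shell` — THE CENTRED COMPUTATION for the explicit shell `P = a(|z|²)∇Y − (b(|z|²)Y) z` with vorticity
  `ω = −c(|z|²) ∇Y × z` (tree: `curl_curl_shell_apply`, `curl_explicitShell_apply`): the Lamb vector is `ω × P = (ρ₁Y² + ρ₂|∇Y|²) z + (ρ₃Y) ∇Y`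
  with radial `ρ₁ = l c b`, `ρ₂ = −c a`, `ρ₃ = c(l a − s b)` (tree: `cross_vorticity_shell`), and `curl(f₁ z + f₂ ∇Y) = ∇f₁ × z + ∇f₂ × ∇Y`
  (tree: `curl_smul_self_add_smul_gradient`) gives `curl(ω × P)(y) = ρ₂ ∇|∇Y|² × y + (2ρ₁ − 2ρ₃′) Y ∇Y × y` (radial gradients are parallel to
  `y`, `∇Y × ∇Y = 0`);
* §3 the profile read-off `K′(r) = 2r c′(r²)` (`deriv_vortAmpL_of_sq`; with the tree's `vortAmpL_eq_of_sq`, `strainAmpL_eq_of_sq`,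
  `deriv_profile_of_sq`), so that near `y ≠ 0` the potential `ψ` is `ρ₂(|z|²)|∇Y|² + ρ₄(|z|²)Y²`, `ρ₄ = l((l−1) c h′ − (l+1) c′ h)`, and
  `l a − s b = l(l+1) h` closes the bookkeeping `ρ₁ − ρ₃′ = ρ₄`;
* §4 ★ `singleShellLambCurlIdentity` — **bridge L VERBATIM** (translation to the centre `x₀`: `sepShellL_eq_comp_sub`, `curl_comp_sub_const_fun`).

HONEST LABEL: explicit-field calculus about SPECIAL separable data (support of a files-only rung line); nothing here bears on `UnthreadedRigidity`
(27585), the door Target, W2 or Navier–Stokes regularity; no summit statement is proved.  MODEL/rung work; 0 kit.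
[cite: MajdaBertozziCUP2002, §1.1 (vector identities), §2.1 (Lamb form)]
-/

noncomputable section

-- the summit and its single sub-problem share the name (CONVENTIONS §1), as in every Theorems file
set_option linter.dupNamespace false

namespace Summit.NavierStokesRegularity.NavierStokesRegularity.Theorems.UnthreadedRigidity.Persistence

open Set Function Filter Topology
open Literature.Analysis.FluidPDE
open Summit.NavierStokesRegularity.NavierStokesRegularity.Theorems.UnthreadedRigidity.ProfileHorn (E3)
open Summit.NavierStokesRegularity.NavierStokesRegularity.Theorems.UnthreadedRigidity.VirialHorn

/-! ## §1 Radial factors and the cross product with the position vector -/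

/-- gradient of a sum at a point of differentiability. [folklore] -/
theorem gradient_add_of_differentiableAt {f g : E3 → ℝ} {y : E3} (hf : DifferentiableAt ℝ f y) (hg : DifferentiableAt ℝ g y) :
    gradient (fun z : E3 => f z + g z) y = gradient f y + gradient g y := by
  rw [gradient, fderiv_fun_add hf hg, map_add]
  rfl

/-- `∇(Y²)(y) = 2Y(y) ∇Y(y)`. [folklore] -/
theorem gradient_sq_of_differentiableAt {Y : E3 → ℝ} {y : E3} (hYd : DifferentiableAt ℝ Y y) :
    gradient (fun z : E3 => Y z ^ 2) y = (2 * Y y) • gradient Y y := by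
  rw [gradient, show (fun z : E3 => Y z ^ 2) = fun z => Y z * Y z from funext fun z => sq (Y z),
    fderiv_fun_mul hYd hYd, map_add, map_smul]
  rw [gradient, two_mul, add_smul]

/-- GRADIENT OF A RADIAL MULTIPLE: `∇(ρ(|z|²) g)(y) = ρ(|y|²) ∇g(y) + (2ρ′(|y|²) g(y)) y`. [folklore] -/
theorem gradient_radial_mul {ρ : ℝ → ℝ} (hρ : Differentiable ℝ ρ) {g : E3 → ℝ} {y : E3} (hg : DifferentiableAt ℝ g y) :
    gradient (fun z : E3 => ρ (‖z‖ ^ 2) * g z) y = ρ (‖y‖ ^ 2) • gradient g y + (2 * deriv ρ (‖y‖ ^ 2) * g y) • y := by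
  have hR : DifferentiableAt ℝ (fun z : E3 => ρ (‖z‖ ^ 2)) y := differentiableAt_radial hρ y
  have h1 : gradient (fun z : E3 => ρ (‖z‖ ^ 2) * g z) y =
      ρ (‖y‖ ^ 2) • gradient g y + g y • gradient (fun z : E3 => ρ (‖z‖ ^ 2)) y := by
    rw [gradient, fderiv_fun_mul hR hg, map_add, map_smul, map_smul]
    rfl
  rw [h1, gradient_radial hρ, smul_smul, mul_comm (g y)]

/-- RADIAL FACTORS PASS THROUGH `∇(·) × y`: `∇(ρ(|z|²) g)(y) × y = ρ(|y|²) (∇g(y) × y)` (`∇ρ(|z|²) ∥ z`). [folklore] -/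
theorem cross_gradient_radial_mul {ρ : ℝ → ℝ} (hρ : Differentiable ℝ ρ) {g : E3 → ℝ} {y : E3} (hg : DifferentiableAt ℝ g y) :
    cross (gradient (fun z : E3 => ρ (‖z‖ ^ 2) * g z) y) y = ρ (‖y‖ ^ 2) • cross (gradient g y) y := by
  -- `(u + v) × y = u × y + v × y` (linearity of `crossCLM`) and `y × y = 0` (tree lemmas elsewhere; kept local here)
  have hadd : ∀ u v : E3, cross (u + v) y = cross u y + cross v y := fun u v => by
    rw [← crossCLM_apply (u + v) y, map_add]
    rfl
  have hyy : cross y y = 0 := by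
    ext i
    fin_cases i <;> simp [cross]
  rw [gradient_radial_mul hρ hg, hadd, cross_smul_left, cross_smul_left, hyy, smul_zero, add_zero]

/-! ## §2 The centred computation: the Lamb curl of an explicit shell -/

/-- ★ THE LAMB CURL OF AN EXPLICIT SHELL, CENTRED.  For the explicit shell `P = a(|z|²)∇Y − (b(|z|²)Y) z` of a solid harmonic `Y` of degree `l`
with vorticity `ω = −c(|z|²) ∇Y × z` (any differentiable radial profiles `a b c`):
`curl(ω × P)(y) = −(ca)(|y|²) ∇|∇Y|²(y) × y + (2l (cb)(|y|²) − 2ρ₃′(|y|²)) Y(y) ∇Y(y) × y`, `ρ₃(s) = c(s)(l a(s) − s b(s))`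
(`ω × P = (l cb Y² − ca|∇Y|²) z + (ρ₃Y)∇Y` by BAC–CAB and Euler, `curl(f₁ z + f₂∇Y) = ∇f₁ × z + ∇f₂ × ∇Y`, radial gradients are parallel to `z`,
`∇Y × ∇Y = 0`). [cite: MajdaBertozziCUP2002, §1.1 (vector identities)] -/
theorem curl_cross_vorticity_shell {l : ℕ} {Y : E3 → ℝ} (hY : IsSolidHarmonic l Y) {a b c : ℝ → ℝ}
    (ha : Differentiable ℝ a) (hb : Differentiable ℝ b) (hc : Differentiable ℝ c) (y : E3) :
    curl (fun z : E3 => cross (-(c (‖z‖ ^ 2) • cross (gradient Y z) z))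
        (a (‖z‖ ^ 2) • gradient Y z - (b (‖z‖ ^ 2) * Y z) • z)) y =
      (-(c (‖y‖ ^ 2) * a (‖y‖ ^ 2))) • cross (gradient (fun z : E3 => ‖gradient Y z‖ ^ 2) y) y
        + (2 * ((l : ℝ) * (c (‖y‖ ^ 2) * b (‖y‖ ^ 2))) * Y y
            - 2 * deriv (fun s : ℝ => c s * (a s * (l : ℝ) - b s * s)) (‖y‖ ^ 2) * Y y) • cross (gradient Y y) y := by
  have hYd : Differentiable ℝ Y := hY.contDiff.differentiable (by simp)
  have hGn : Differentiable ℝ (fun z : E3 => ‖gradient Y z‖ ^ 2) :=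
    (hY.contDiff_gradient.differentiable (by simp)).norm_sq ℝ
  -- the radial profiles of the Lamb vector `ω × P = (ρ₁ Y² + ρ₂ |∇Y|²) z + (ρ₃ Y) ∇Y`
  obtain ⟨ρ₁, hρ₁⟩ : ∃ ρ₁ : ℝ → ℝ, ρ₁ = fun s => (l : ℝ) * (c s * b s) := ⟨_, rfl⟩
  obtain ⟨ρ₂, hρ₂⟩ : ∃ ρ₂ : ℝ → ℝ, ρ₂ = fun s => -(c s * a s) := ⟨_, rfl⟩
  obtain ⟨ρ₃, hρ₃⟩ : ∃ ρ₃ : ℝ → ℝ, ρ₃ = fun s => c s * (a s * (l : ℝ) - b s * s) := ⟨_, rfl⟩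
  have hρ₁d : Differentiable ℝ ρ₁ := by
    rw [hρ₁]
    exact (hc.mul hb).const_mul _
  have hρ₂d : Differentiable ℝ ρ₂ := by
    rw [hρ₂]
    exact (hc.mul ha).neg
  have hρ₃d : Differentiable ℝ ρ₃ := by
    rw [hρ₃]
    exact hc.mul ((ha.mul_const _).sub (hb.mul differentiable_id))
  have hfield : (fun z : E3 => cross (-(c (‖z‖ ^ 2) • cross (gradient Y z) z))
        (a (‖z‖ ^ 2) • gradient Y z - (b (‖z‖ ^ 2) * Y z) • z)) =
      fun z : E3 => (ρ₁ (‖z‖ ^ 2) * Y z ^ 2 + ρ₂ (‖z‖ ^ 2) * ‖gradient Y z‖ ^ 2) • z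
        + (ρ₃ (‖z‖ ^ 2) * Y z) • gradient Y z := by
    funext z
    rw [cross_vorticity_shell hY]
    simp only [hρ₁, hρ₂, hρ₃]
    module
  -- differentiability of the coefficients
  have hs1 : DifferentiableAt ℝ (fun z : E3 => ρ₁ (‖z‖ ^ 2) * Y z ^ 2) y :=
    (differentiableAt_radial hρ₁d y).mul ((hYd y).fun_pow 2)
  have hs2 : DifferentiableAt ℝ (fun z : E3 => ρ₂ (‖z‖ ^ 2) * ‖gradient Y z‖ ^ 2) y :=
    (differentiableAt_radial hρ₂d y).mul (hGn y)
  have h₁ : DifferentiableAt ℝ (fun z : E3 => ρ₁ (‖z‖ ^ 2) * Y z ^ 2 + ρ₂ (‖z‖ ^ 2) * ‖gradient Y z‖ ^ 2) y := hs1.add hs2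
  have h₂ : DifferentiableAt ℝ (fun z : E3 => ρ₃ (‖z‖ ^ 2) * Y z) y := (differentiableAt_radial hρ₃d y).mul (hYd y)
  rw [hfield, curl_smul_self_add_smul_gradient hY h₁ h₂]
  -- `(u + v) × w = u × w + v × w` (linearity of `crossCLM`) and `∇Y × ∇Y = 0`
  have hadd : ∀ u v w : E3, cross (u + v) w = cross u w + cross v w := fun u v w => by
    rw [← crossCLM_apply (u + v) w, map_add]
    rfl
  have hself : cross (gradient Y y) (gradient Y y) = 0 := by
    ext i
    fin_cases i <;> simp [cross]
  -- `∇f₁ × y = ρ₁ ∇(Y²) × y + ρ₂ ∇|∇Y|² × y`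
  rw [gradient_add_of_differentiableAt hs1 hs2, hadd, cross_gradient_radial_mul hρ₁d ((hYd y).fun_pow 2),
    cross_gradient_radial_mul hρ₂d (hGn y), gradient_sq_of_differentiableAt (hYd y), cross_smul_left]
  -- `∇f₂ × ∇Y = (2ρ₃′ Y) y × ∇Y`
  rw [gradient_radial_mul hρ₃d (hYd y), hadd, cross_smul_left, cross_smul_left, hself, smul_zero,
    zero_add, cross_swap y (gradient Y y)]
  simp only [hρ₁, hρ₂, hρ₃]
  module

/-! ## §3 The profile read-off `K′(r) = 2r c′(r²)` -/

/-- READ-OFF OF THE DERIVATIVE OF THE VORTICITY AMPLITUDE: `K′(r) = 2r c′(r²)` for `r > 0`, `c(s) = 4 s h″(s) + (4l+6) h′(s)`, when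
`H(r) = h(r²)` on `[0,∞)` (`K = vortAmpL l H` agrees with `r ↦ c(r²)` near `r`, tree `vortAmpL_eq_of_sq`). [folklore] -/
theorem deriv_vortAmpL_of_sq (l : ℕ) {H h : ℝ → ℝ} (hh : ContDiff ℝ (⊤ : ℕ∞) h) (hHh : ∀ r : ℝ, 0 ≤ r → H r = h (r ^ 2))
    {r : ℝ} (hr : 0 < r) :
    deriv (vortAmpL l H) r =
      2 * r * deriv (fun s : ℝ => 4 * s * deriv (deriv h) s + (4 * (l : ℝ) + 6) * deriv h s) (r ^ 2) := by
  obtain ⟨c, hc⟩ : ∃ c : ℝ → ℝ, c = fun s : ℝ => 4 * s * deriv (deriv h) s + (4 * (l : ℝ) + 6) * deriv h s := ⟨_, rfl⟩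
  have hh' : ContDiff ℝ (⊤ : ℕ∞) (deriv h) := contDiff_deriv_of_contDiff_top hh
  have hh'' : ContDiff ℝ (⊤ : ℕ∞) (deriv (deriv h)) := contDiff_deriv_of_contDiff_top hh'
  have hcd : Differentiable ℝ c := by
    rw [hc]
    exact (((contDiff_const.mul contDiff_id).mul hh'').add (contDiff_const.mul hh')).differentiable (by simp)
  have hev : vortAmpL l H =ᶠ[𝓝 r] fun r' : ℝ => c (r' ^ 2) := by
    filter_upwards [Ioi_mem_nhds hr] with r' hr'
    rw [vortAmpL_eq_of_sq l hh hHh hr', hc]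
  have hsq : HasDerivAt (fun x : ℝ => x ^ 2) (2 * r) r := (hasDerivAt_pow 2 r).congr_deriv (by ring)
  have h1 : HasDerivAt c (deriv c (r ^ 2)) (r ^ 2) := (hcd (r ^ 2)).hasDerivAt
  have hd : HasDerivAt (fun r' : ℝ => c (r' ^ 2)) (deriv c (r ^ 2) * (2 * r)) r :=
    HasDerivAt.comp (h₂ := c) (h := fun x : ℝ => x ^ 2) r h1 hsq
  rw [hev.deriv_eq, hd.deriv, ← hc]
  ring

/-! ## §4 ★ Bridge L, VERBATIM -/

/-- ★ **Bridge L «LAMB-CURL IDENTITY» — the sketch's `SingleShellLambCurlIdentity` VERBATIM** (the sketch-local `lambCurl`, `lambPot`, `balAmp`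
unfolded): for the single separable shell `u = sepShellL H Y x₀` of a solid harmonic `Y` of degree `l ≥ 1` with a virial-admissible profile `H`,
`curl(ω × u)(x₀ + y) = ∇ψ(y) × y` for every `y ≠ 0`, where `ψ(y) = −K(|y|)α(|y|)|∇Y(y)|² + b_l[H](|y|) Y(y)²`,
`b_l[H](r) = (l/2r)((l−1) K H′ − (l+1) K′ H)`, `K = vortAmpL l H`, `α = strainAmpL l H`.
PROOF: translate to the centre (`sepShellL_eq_comp_sub`, `curl_comp_sub_const_fun`); the centred shell is `a(|z|²)∇Y − (b(|z|²)Y) z` with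
vorticity `−c(|z|²) ∇Y × z`, `a = 2sh′ + (l+1)h`, `b = 2lh′`, `c = 2a′ + b = 4sh″ + (4l+6)h′` (`curl_curl_shell_apply`, `curl_explicitShell_apply`);
§2 computes `curl(ω × P)`; near `y ≠ 0` the potential is the same radial combination by the read-offs `K(r) = c(r²)`, `α(r) = a(r²)`,
`H′(r) = 2rh′(r²)`, `K′(r) = 2rc′(r²)`, and `l a − s b = l(l+1) h` matches the `Y²`-coefficients. -/
theorem singleShellLambCurlIdentity :
    ∀ (l : ℕ) (H : ℝ → ℝ) (Y : E3 → ℝ) (x₀ : E3), 1 ≤ l → IsSolidHarmonic l Y → VirialAdmissible l H →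
      ∀ y : E3, y ≠ 0 →
        curl (fun x => cross (curl (sepShellL H Y x₀) x) (sepShellL H Y x₀ x)) (x₀ + y)
          = cross (gradient (fun y => -(vortAmpL l H ‖y‖ * strainAmpL l H ‖y‖) * ‖gradient Y y‖ ^ 2
              + (l : ℝ) / (2 * ‖y‖) * (((l : ℝ) - 1) * vortAmpL l H ‖y‖ * deriv H ‖y‖
                  - ((l : ℝ) + 1) * deriv (vortAmpL l H) ‖y‖ * H ‖y‖) * Y y ^ 2) y) y := by
  intro l H Y x₀ _ hY hH y hy
  obtain ⟨h, hh, hHh⟩ := hH.1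
  have hh' : ContDiff ℝ (⊤ : ℕ∞) (deriv h) := contDiff_deriv_of_contDiff_top hh
  have hh'' : ContDiff ℝ (⊤ : ℕ∞) (deriv (deriv h)) := contDiff_deriv_of_contDiff_top hh'
  have hd0 : Differentiable ℝ h := hh.differentiable (by simp)
  have hYd : Differentiable ℝ Y := hY.contDiff.differentiable (by simp)
  have hGn : Differentiable ℝ (fun z : E3 => ‖gradient Y z‖ ^ 2) :=
    (hY.contDiff_gradient.differentiable (by simp)).norm_sq ℝ
  -- the radial profiles: strain `a`, `b`, vorticity `c`
  obtain ⟨a, ha_def⟩ : ∃ a : ℝ → ℝ, a = fun s => 2 * s * deriv h s + ((l : ℝ) + 1) * h s := ⟨_, rfl⟩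
  obtain ⟨b, hb_def⟩ : ∃ b : ℝ → ℝ, b = fun s => 2 * (l : ℝ) * deriv h s := ⟨_, rfl⟩
  obtain ⟨c, hc_def⟩ : ∃ c : ℝ → ℝ, c = fun s => 4 * s * deriv (deriv h) s + (4 * (l : ℝ) + 6) * deriv h s := ⟨_, rfl⟩
  have ha : ContDiff ℝ (⊤ : ℕ∞) a := by
    rw [ha_def]
    exact ((contDiff_const.mul contDiff_id).mul hh').add (contDiff_const.mul hh)
  have hb : ContDiff ℝ (⊤ : ℕ∞) b := by
    rw [hb_def]
    exact contDiff_const.mul hh'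
  have hc : ContDiff ℝ (⊤ : ℕ∞) c := by
    rw [hc_def]
    exact ((contDiff_const.mul contDiff_id).mul hh'').add (contDiff_const.mul hh')
  have had : Differentiable ℝ a := ha.differentiable (by simp)
  have hbd : Differentiable ℝ b := hb.differentiable (by simp)
  have hcd : Differentiable ℝ c := hc.differentiable (by simp)
  have hc'd : Differentiable ℝ (deriv c) := (contDiff_deriv_of_contDiff_top hc).differentiable (by simp)
  have hc_eq : ∀ s : ℝ, 2 * deriv a s + b s = c s := fun s => by
    simp only [ha_def, hb_def, hc_def, deriv_strainProfile hh l s]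
    ring
  -- Step 1: the shell is the translate of the explicit centred shell `P`; its vorticity is `−c ∇Y × z`, translated
  obtain ⟨P, hP⟩ : ∃ P : E3 → E3, P = fun z : E3 => a (‖z‖ ^ 2) • gradient Y z - (b (‖z‖ ^ 2) * Y z) • z := ⟨_, rfl⟩
  have hshell : curl (curl (fun z : E3 => (h (‖z‖ ^ 2) * Y z) • z)) = P := by
    funext z
    rw [curl_curl_shell_apply (hh.of_le (by norm_cast)) hY z]
    simp only [hP, ha_def, hb_def]
  have hv : sepShellL H Y x₀ = fun x : E3 => P (x - x₀) := by
    rw [sepShellL_eq_comp_sub hHh Y x₀, hshell]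
  have hω : curl (sepShellL H Y x₀) = fun x : E3 => -(c (‖x - x₀‖ ^ 2) • cross (gradient Y (x - x₀)) (x - x₀)) := by
    rw [hv, curl_comp_sub_const_fun P x₀]
    funext x
    rw [hP, curl_explicitShell_apply (ha.of_le (by norm_cast)) (hb.of_le (by norm_cast)) hY (x - x₀), hc_eq]
  -- Step 2: the Lamb vector field is the translate of the centred one
  obtain ⟨L, hL⟩ : ∃ L : E3 → E3, L = fun z : E3 => cross (-(c (‖z‖ ^ 2) • cross (gradient Y z) z))
      (a (‖z‖ ^ 2) • gradient Y z - (b (‖z‖ ^ 2) * Y z) • z) := ⟨_, rfl⟩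
  have hLamb : (fun x : E3 => cross (curl (sepShellL H Y x₀) x) (sepShellL H Y x₀ x)) = fun x : E3 => L (x - x₀) := by
    funext x
    rw [hω]
    simp only [hv, hL, hP]
  rw [hLamb, curl_comp_sub_const_fun L x₀]
  simp only [add_sub_cancel_left]
  -- Step 3: the centred Lamb curl (§2)
  rw [hL, curl_cross_vorticity_shell hY had hbd hcd y]
  -- Step 4: the potential near `y ≠ 0` in the variable `s = |z|²`
  obtain ⟨ρ₂, hρ₂⟩ : ∃ ρ₂ : ℝ → ℝ, ρ₂ = fun s => -(c s * a s) := ⟨_, rfl⟩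
  obtain ⟨ρ₄, hρ₄⟩ : ∃ ρ₄ : ℝ → ℝ,
      ρ₄ = fun s => (l : ℝ) * (((l : ℝ) - 1) * c s * deriv h s - ((l : ℝ) + 1) * deriv c s * h s) := ⟨_, rfl⟩
  have hρ₂d : Differentiable ℝ ρ₂ := by
    rw [hρ₂]
    exact (hcd.mul had).neg
  have hρ₄d : Differentiable ℝ ρ₄ := by
    rw [hρ₄]
    exact (((hcd.const_mul _).mul (hh'.differentiable (by simp))).sub ((hc'd.const_mul _).mul hd0)).const_mul _
  have hpot : (fun z : E3 => -(vortAmpL l H ‖z‖ * strainAmpL l H ‖z‖) * ‖gradient Y z‖ ^ 2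
        + (l : ℝ) / (2 * ‖z‖) * (((l : ℝ) - 1) * vortAmpL l H ‖z‖ * deriv H ‖z‖
            - ((l : ℝ) + 1) * deriv (vortAmpL l H) ‖z‖ * H ‖z‖) * Y z ^ 2)
      =ᶠ[𝓝 y] fun z : E3 => ρ₂ (‖z‖ ^ 2) * ‖gradient Y z‖ ^ 2 + ρ₄ (‖z‖ ^ 2) * Y z ^ 2 := by
    filter_upwards [eventually_ne_nhds hy] with z hz
    have hr : 0 < ‖z‖ := norm_pos_iff.mpr hz
    have hK : vortAmpL l H ‖z‖ = c (‖z‖ ^ 2) := by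
      rw [vortAmpL_eq_of_sq l hh hHh hr, hc_def]
    have hα : strainAmpL l H ‖z‖ = a (‖z‖ ^ 2) := by
      rw [strainAmpL_eq_of_sq l hh hHh hr, ha_def]
    have hK' : deriv (vortAmpL l H) ‖z‖ = 2 * ‖z‖ * deriv c (‖z‖ ^ 2) := by
      rw [deriv_vortAmpL_of_sq l hh hHh hr, hc_def]
    have hH' : deriv H ‖z‖ = 2 * ‖z‖ * deriv h (‖z‖ ^ 2) := deriv_profile_of_sq hh hHh hr
    have hH0 : H ‖z‖ = h (‖z‖ ^ 2) := hHh ‖z‖ hr.le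
    have hbal : (l : ℝ) / (2 * ‖z‖) * (((l : ℝ) - 1) * c (‖z‖ ^ 2) * (2 * ‖z‖ * deriv h (‖z‖ ^ 2))
        - ((l : ℝ) + 1) * (2 * ‖z‖ * deriv c (‖z‖ ^ 2)) * h (‖z‖ ^ 2)) = ρ₄ (‖z‖ ^ 2) := by
      simp only [hρ₄]
      rw [div_mul_eq_mul_div, div_eq_iff (by positivity)]
      ring
    rw [hK, hα, hK', hH', hH0, hbal, hρ₂]
  have hgrad : gradient (fun z : E3 => -(vortAmpL l H ‖z‖ * strainAmpL l H ‖z‖) * ‖gradient Y z‖ ^ 2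
        + (l : ℝ) / (2 * ‖z‖) * (((l : ℝ) - 1) * vortAmpL l H ‖z‖ * deriv H ‖z‖
            - ((l : ℝ) + 1) * deriv (vortAmpL l H) ‖z‖ * H ‖z‖) * Y z ^ 2) y
      = gradient (fun z : E3 => ρ₂ (‖z‖ ^ 2) * ‖gradient Y z‖ ^ 2 + ρ₄ (‖z‖ ^ 2) * Y z ^ 2) y := by
    exact hpot.gradient_eq
  have hs2 : DifferentiableAt ℝ (fun z : E3 => ρ₂ (‖z‖ ^ 2) * ‖gradient Y z‖ ^ 2) y :=
    (differentiableAt_radial hρ₂d y).mul (hGn y)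
  have hs4 : DifferentiableAt ℝ (fun z : E3 => ρ₄ (‖z‖ ^ 2) * Y z ^ 2) y :=
    (differentiableAt_radial hρ₄d y).mul ((hYd y).fun_pow 2)
  have hadd : ∀ u v : E3, cross (u + v) y = cross u y + cross v y := fun u v => by
    rw [← crossCLM_apply (u + v) y, map_add]
    rfl
  rw [hgrad, gradient_add_of_differentiableAt hs2 hs4, hadd, cross_gradient_radial_mul hρ₂d (hGn y),
    cross_gradient_radial_mul hρ₄d ((hYd y).fun_pow 2), gradient_sq_of_differentiableAt (hYd y), cross_smul_left]
  -- Step 5: the bookkeeping `l a − s b = l(l+1) h`, `ρ₁ − ρ₃′ = ρ₄`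
  have hρ₃' : deriv (fun s : ℝ => c s * (a s * (l : ℝ) - b s * s)) (‖y‖ ^ 2) =
      (l : ℝ) * ((l : ℝ) + 1) * (deriv c (‖y‖ ^ 2) * h (‖y‖ ^ 2) + c (‖y‖ ^ 2) * deriv h (‖y‖ ^ 2)) := by
    have e : (fun s : ℝ => c s * (a s * (l : ℝ) - b s * s)) = fun s => ((l : ℝ) * ((l : ℝ) + 1)) * (c s * h s) := by
      funext s
      simp only [ha_def, hb_def]
      ring
    have h1 : HasDerivAt (fun s : ℝ => c s * h s)
        (deriv c (‖y‖ ^ 2) * h (‖y‖ ^ 2) + c (‖y‖ ^ 2) * deriv h (‖y‖ ^ 2)) (‖y‖ ^ 2) :=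
      ((hcd _).hasDerivAt).mul ((hd0 _).hasDerivAt)
    rw [e, deriv_const_mul _ h1.differentiableAt, h1.deriv]
  rw [hρ₃']
  simp only [hρ₂, hρ₄, hb_def]
  module

end Summit.NavierStokesRegularity.NavierStokesRegularity.Theorems.UnthreadedRigidity.Persistence

end
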